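import Literature.IUT.HodgeTheaters.DiscreteProfiniteConjugates
import Literature.AnabelianGeometry.SemiGraphs.TemperedAnabelian
import Mathlib.GroupTheory.SpecificGroups.Dihedral
import Mathlib.SetTheory.Cardinal.Free
import HarnessLib

/-!
# [IUTchI] Theorem 2.6 ⇒ [SemiAnbd] Lemma 6.1 (i) ([André] Lemma 3.2.1): the bridge

Mochizuki, *Inter-universal Teichmüller theory I*, kurims manuscript (May 2020), §2, p. 56: Theorem 2.6
and Lemma 2.7 are "'discrete analogues' of Prop. 2.4 / Cor. 2.5 which may be regarded as
generalizations of [André], Lemma 3.2.1; [EtTh], Lemma 2.17, (i)" [cite: Mochizuki2012, Thm 2.6 p.56];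
and Mochizuki, *Semi-graphs of anabelioids*, §6, Lemma 6.1 (i), author's ms p. 69: "Let `F` be a
finitely generated free group of rank `> 1`. Then `N_{F̂}(F) = F`" (proof in print: [André] Lem. 3.2.1)
[cite: MochizukiSemiAnbd2006, Lem 6.1(i) p.69].

PROOF-ONLY bridge (no definitions): the typed named statement
`Literature.AnabelianGeometry.SemiGraphs.FreeGroupNormallyTerminalInCompletion` ([SemiAnbd] Lem 6.1 (i),
abc-iut-L3-t4) is LITERALLY the special case `F = G = H = F_n` (`n > 1`) of the typed named statement
`Literature.IUT.HodgeTheaters.ProfiniteConjugatesOfDiscreteSubgroups.{0}` ([IUTchI] Thm 2.6,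
abc-iut-L5-t1): a `γ ∈ F̂_n` normalising (the image of) `F_n` satisfies `γ · F_n · γ⁻¹ ⊆ F_n`, and
`F_n ∩ F_n = F_n` is nonabelian, so conclusion (b) of Theorem 2.6 gives `γ ∈ F_n`.  Hence the kernel
closes [SemiAnbd] Lem 6.1 (i) BY NAME the moment Theorem 2.6 is proved (abc-iut-L5-t9's assembly,
itself modulo conjugacy separability of free groups until that lands); no statement is restated or
weakened; the unconditional route of abc-iut-L3-d3 is untouched.  Nothing here takes a side on
[IUTchIII] Cor. 3.12; typed ≠ discharged.
-/

namespace Literature.IUT.HodgeTheaters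

open Literature.AnabelianGeometry.SemiGraphs

/-- Two distinct free generators of a free group do not commute (detected in the dihedral group of
order `6`: `r · s ≠ s · r`). [cite: Mochizuki2012, Thm 2.6 p.56] -/
theorem FreeGroup.of_mul_of_ne_of_ne {ι : Type*} {i j : ι} (hij : i ≠ j) :
    FreeGroup.of i * FreeGroup.of j ≠ FreeGroup.of j * FreeGroup.of i := by
  classical
  intro h
  let f : ι → DihedralGroup 3 := fun k => if k = i then DihedralGroup.r 1 else DihedralGroup.sr 0
  have hfi : f i = DihedralGroup.r 1 := if_pos rfl
  have hfj : f j = DihedralGroup.sr 0 := if_neg (Ne.symm hij)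
  have := congrArg (FreeGroup.lift f) h
  rw [map_mul, map_mul, FreeGroup.lift_apply_of, FreeGroup.lift_apply_of, hfi, hfj] at this
  exact absurd this (by decide)

/-- **[IUTchI] Theorem 2.6 ⇒ [SemiAnbd] Lemma 6.1 (i)** (= [André] Lemma 3.2.1): if the typed
Theorem 2.6 (`ProfiniteConjugatesOfDiscreteSubgroups`, at universe `0`) holds, then for every `n > 1`
the image of the free group `F_n` in its profinite completion is its own normalizer.  Apply Theorem 2.6
with `F = G = H = F_n` and a normalising `γ`: `F_n` is free of finite rank, infinite, and
`H_G = F_n` contains the noncommuting pair `x₀, x₁`. [cite: Mochizuki2012, Thm 2.6 p.56] -/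
theorem freeGroupNormallyTerminalInCompletion_of_thm26
    (h26 : ProfiniteConjugatesOfDiscreteSubgroups.{0}) : FreeGroupNormallyTerminalInCompletion := by
  intro n hn
  refine le_antisymm ?_ Subgroup.le_normalizer
  intro γ hγ
  -- the data of Theorem 2.6: `F = G = H = F_n`
  haveI : Nonempty (Fin n) := ⟨⟨0, by omega⟩⟩
  have hG : IsFreeOrSurface (⊤ : Subgroup (FreeGroup (Fin n))) :=
    Or.inl ⟨n, ⟨Subgroup.topEquiv⟩⟩
  have hH : ((⊤ : Subgroup (FreeGroup (Fin n))) : Set (FreeGroup (Fin n))).Infinite := by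
    rw [Subgroup.coe_top]
    exact Set.infinite_univ
  have hγ' : ∀ x ∈ (⊤ : Subgroup (FreeGroup (Fin n))),
      γ * toCompletion (FreeGroup (Fin n)) x * γ⁻¹ ∈ (toCompletion (FreeGroup (Fin n))).range :=
    fun x _ => (Subgroup.mem_normalizer_iff.mp hγ _).mp ⟨x, rfl⟩
  obtain ⟨-, hb⟩ := h26 (FreeGroup (Fin n)) ⊤ ⊤ inferInstance hG hH γ hγ'
  -- `H ∩ G = F_n` is nonabelian since `n > 1`
  refine hb ⟨FreeGroup.of ⟨0, by omega⟩, ⟨trivial, trivial⟩, FreeGroup.of ⟨1, hn⟩,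
    ⟨trivial, trivial⟩, FreeGroup.of_mul_of_ne_of_ne ?_⟩
  simp [Fin.ext_iff]

end Literature.IUT.HodgeTheaters
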